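import Summits.CriticalPhenomena.PercolationContinuityZ3.Theorems.PercNearOneGluingNoHeavyLowerTailSunflowerOrPetalPlacements
import HarnessLib

/-!
# `NoHeavyLowerTail` (crux stmt-CriticalPhenomena-4575), abstract sunflower cubic: the POINTWISE THEOREM for block codes behind a
# disjunctive petal — marked sectors and the bottom sector

Support file (seat `prim-ineq-gen-2` gen 23; `--supports stmt-CriticalPhenomena-4575`).  No `sorry`, no named facts.  Third of four files
proving (♣) behind every disjunctive petal: for every nonempty `S₀` and every triple of admissible block codes (`IsCode`,
`…SunflowerOrPetalCodes`), `2·codeRows ≤ codeSum` (`two_mul_codeRows_le_codeSum`).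

PROOF (`codeD = codeSum − 2·codeRows`; `2·codeD = 2·oneSum + Σ_σ pairSum σ + 2·threeSum`).  Codes are read through the finite state tables
(`exists_oneState_of_code`, `exists_pairState_of_code`); `threeSum ≥ 0` always (lifted labels).
* MARKED SECTORS (`codeD_nonneg_marked`, some free label `≠ 0`): every `pairSum σ ≥ 0`; `oneSum ≥ −2`, and `oneSum < 0` pins two marked
  blocks and a bottom block with a proper kernel trace `σ₀` (`rowT = 0`, label of `S₀` = `4`), whose pair pays: `pairSum σ₀, pairSum (S₀∖σ₀) ≥ 4`
  (`codeD_nonneg_of_trace`; the other positions by the symmetries `codeD_swap12/23`).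
* BOTTOM SECTOR (`codeD_nonneg_bottom`, all free labels `0`): with `𝒟 = dset` the proper traces that are petal in all three blocks with
  kernel complement in all three: `oneSum ≥ 0`, `= 12` if `𝒟 ≠ ∅`; `pairSum σ ≥ −12·([σ ∈ 𝒟] + [S₀∖σ ∈ 𝒟])` hence `Σ_σ pairSum σ ≥ −24·#𝒟`;
  `threeSum ≥ 4·#T` with `T` the three-block placements having two blocks in `𝒟` (those show at most one kernel label); and the LEMMA
  `#T ≥ 3(#𝒟 − 1)` (`card_twoIn_ge`, `…SunflowerOrPetalPlacements`; `𝒟` is down-closed by monotonicity and a kernel complement is never a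
  petal singleton).  Total `2·codeD ≥ 24 − 24·#𝒟 + 24(#𝒟 − 1) = 0`.
Tight cases: equal dictators, `(∅, all, all)`; memo run/shared/lean/prim/prim-ineq-gen-2/gen23/CLUB-ORPETAL-ALL-R.md.
-/

namespace Summit.CriticalPhenomena.PercolationContinuityZ3.Theorems.SunflowerPartition

open Finset

variable {α : Type*} [DecidableEq α]

/-! ## Codes through states -/

section codes

variable {S₀ : Finset α} {g g₁ g₂ g₃ : Finset α → Fin 5}

/-- The pair state of a code at a proper subset. [this work] -/
theorem exists_pairState_of_code (h : IsCode S₀ g) {σ : Finset α} (hσ : σ ∈ propers S₀) :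
    ∃ s : Fin 7, psL s = g ∅ ∧ psA s = g σ ∧ psB s = g (S₀ \ σ) := by
  obtain ⟨h1, h2, _⟩ := mem_propers.1 hσ
  have hσ' := sdiff_mem_propers hσ
  obtain ⟨_, h2', _⟩ := mem_propers.1 hσ'
  exact exists_pairState _ _ _ h.free (h.lift h1 (nonempty_iff_ne_empty.2 h2))
    (h.lift sdiff_subset (nonempty_iff_ne_empty.2 h2'))
    (fun hm => h.eq_four_of_marked hm h1 (nonempty_iff_ne_empty.2 h2))
    (fun hm => h.eq_four_of_marked hm sdiff_subset (nonempty_iff_ne_empty.2 h2'))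

/-- The one-block state of a code. [this work] -/
theorem exists_oneState_of_code (h : IsCode S₀ g) (h₀ : S₀.Nonempty) :
    ∃ s : Fin 6, osL s = g ∅ ∧ osTop s = g S₀ ∧ osT s = rowT S₀ g := by
  have hL : g S₀ = 3 ∨ g S₀ = 4 := h.lift subset_rfl h₀
  have hmL : g ∅ ≠ 0 → g S₀ = 4 := fun hm => h.eq_four_of_marked hm subset_rfl h₀
  by_cases hP : g ∅ ≠ 0 ∨ (g S₀ = 4 ∧ ∀ σ ∈ propers S₀, g σ = 3)
  · obtain ⟨s, e1, e2, e3⟩ := exists_oneState (g ∅) (g S₀) true h.free hL hmL (fun _ => rfl)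
      (fun h3 => by
        rcases hP with hm | ⟨h4, _⟩
        · rw [hmL hm] at h3; exact absurd h3 (by decide)
        · rw [h4] at h3; exact absurd h3 (by decide))
    refine ⟨s, e1, e2, ?_⟩
    rw [e3, rowT, if_pos hP]; rfl
  · have hm : ¬ g ∅ ≠ 0 := fun hm => hP (Or.inl hm)
    obtain ⟨s, e1, e2, e3⟩ := exists_oneState (g ∅) (g S₀) false h.free hL hmL (fun h' => absurd h' hm)
      (fun _ => rfl)
    refine ⟨s, e1, e2, ?_⟩
    rw [e3, rowT, if_neg hP]; rfl

/-- `pairSum` through pair states. [this work] -/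
theorem pairSum_eq_pairOf {σ : Finset α} {s₁ s₂ s₃ : Fin 7}
    (a₁ : psL s₁ = g₁ ∅) (b₁ : psA s₁ = g₁ σ) (c₁ : psB s₁ = g₁ (S₀ \ σ))
    (a₂ : psL s₂ = g₂ ∅) (b₂ : psA s₂ = g₂ σ) (c₂ : psB s₂ = g₂ (S₀ \ σ))
    (a₃ : psL s₃ = g₃ ∅) (b₃ : psA s₃ = g₃ σ) (c₃ : psB s₃ = g₃ (S₀ \ σ)) :
    pairSum S₀ g₁ g₂ g₃ σ = pairOf s₁ s₂ s₃ := by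
  unfold pairSum pairOf
  rw [a₁, b₁, c₁, a₂, b₂, c₂, a₃, b₃, c₃]

/-- `oneSum` through one-block states. [this work] -/
theorem oneSum_eq_oneOf {s₁ s₂ s₃ : Fin 6}
    (a₁ : osL s₁ = g₁ ∅) (b₁ : osTop s₁ = g₁ S₀) (c₁ : osT s₁ = rowT S₀ g₁)
    (a₂ : osL s₂ = g₂ ∅) (b₂ : osTop s₂ = g₂ S₀) (c₂ : osT s₂ = rowT S₀ g₂)
    (a₃ : osL s₃ = g₃ ∅) (b₃ : osTop s₃ = g₃ S₀) (c₃ : osT s₃ = rowT S₀ g₃) :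
    oneSum S₀ g₁ g₂ g₃ = oneOf s₁ s₂ s₃ := by
  unfold oneSum codeRows oneOf
  rw [a₁, b₁, c₁, a₂, b₂, c₂, a₃, b₃, c₃]

/-- The three-block placements are nonnegative for codes. [this work] -/
theorem threeSum_nonneg (h₁ : IsCode S₀ g₁) (h₂ : IsCode S₀ g₂) (h₃ : IsCode S₀ g₃) : 0 ≤ threeSum S₀ g₁ g₂ g₃ := by
  unfold threeSum
  refine sum_nonneg fun X hX => sum_nonneg fun Y hY => ?_
  obtain ⟨hX1, hX2, hY1, hY2, _, hZ1, hZ2⟩ := three_blocks hX hY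
  exact club6_nonneg_of_ge3 _ _ _ (h₁.lift hX1 hX2) (h₂.lift hY1 hY2) (h₃.lift hZ1 hZ2)

/-- With a marked block, every complementary pair contributes nonnegatively. [this work] -/
theorem pairSum_nonneg_marked (h₁ : IsCode S₀ g₁) (h₂ : IsCode S₀ g₂) (h₃ : IsCode S₀ g₃)
    (hm : g₁ ∅ ≠ 0 ∨ g₂ ∅ ≠ 0 ∨ g₃ ∅ ≠ 0) {σ : Finset α} (hσ : σ ∈ propers S₀) : 0 ≤ pairSum S₀ g₁ g₂ g₃ σ := by
  obtain ⟨s₁, a₁, b₁, c₁⟩ := exists_pairState_of_code h₁ hσ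
  obtain ⟨s₂, a₂, b₂, c₂⟩ := exists_pairState_of_code h₂ hσ
  obtain ⟨s₃, a₃, b₃, c₃⟩ := exists_pairState_of_code h₃ hσ
  rw [pairSum_eq_pairOf a₁ b₁ c₁ a₂ b₂ c₂ a₃ b₃ c₃]
  refine pairOf_nonneg_marked s₁ s₂ s₃ ?_
  rw [psL_ne_zero_iff, psL_ne_zero_iff, psL_ne_zero_iff, a₁, a₂, a₃]
  exact hm

/-! ### Symmetries of the pointwise functional -/

/-- The pointwise functional `codeSum − 2·codeRows`. [this work] -/
def codeD (S₀ : Finset α) (g₁ g₂ g₃ : Finset α → Fin 5) : ℤ := codeSum S₀ g₁ g₂ g₃ - 2 * codeRows S₀ g₁ g₂ g₃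

/-- `codeD` is invariant under swapping the first two codes. [this work] -/
theorem codeD_swap12 (S₀ : Finset α) (g₁ g₂ g₃ : Finset α → Fin 5) : codeD S₀ g₁ g₂ g₃ = codeD S₀ g₂ g₁ g₃ := by
  unfold codeD codeSum codeRows
  rw [sum_partsOf_swap12 S₀ (fun a b c => club6 (g₁ a) (g₂ b) (g₃ c))]
  rw [sum_congr rfl fun r _ => club6_swap12 (g₁ r.2) (g₂ r.1) (g₃ (S₀ \ (r.1 ∪ r.2))), kk_comm (g₁ ∅) (g₂ ∅)]
  ring

/-- `codeD` is invariant under swapping the last two codes. [this work] -/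
theorem codeD_swap23 (S₀ : Finset α) (g₁ g₂ g₃ : Finset α → Fin 5) : codeD S₀ g₁ g₂ g₃ = codeD S₀ g₁ g₃ g₂ := by
  unfold codeD codeSum codeRows
  rw [sum_partsOf_swap23 S₀ (fun a b c => club6 (g₁ a) (g₂ b) (g₃ c))]
  rw [sum_congr rfl fun r _ => club6_swap23 (g₁ r.1) (g₂ (S₀ \ (r.1 ∪ r.2))) (g₃ r.2), kk_comm (g₂ ∅) (g₃ ∅)]
  ring

/-! ### The marked sectors -/

/-- Two marked blocks and a bottom block with a proper kernel trace: `codeD ≥ 0` (the `−2` of the one-block placements is paid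
by the pair of that trace). [this work] -/
theorem codeD_nonneg_of_trace (h₀ : S₀.Nonempty) (h₁ : IsCode S₀ g₁) (h₂ : IsCode S₀ g₂) (h₃ : IsCode S₀ g₃)
    (m₁ : g₁ ∅ ≠ 0) (m₂ : g₂ ∅ ≠ 0) (b₃ : g₃ ∅ = 0) {σ₀ : Finset α} (hσ₀ : σ₀ ∈ propers S₀) (hk : g₃ σ₀ = 4) :
    0 ≤ codeD S₀ g₁ g₂ g₃ := by
  have hdec := two_mul_codeSum_sub h₀ g₁ g₂ g₃
  have hthree := threeSum_nonneg h₁ h₂ h₃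
  -- one-block placements ≥ −2
  obtain ⟨s₁, a₁, e₁, c₁⟩ := exists_oneState_of_code h₁ h₀
  obtain ⟨s₂, a₂, e₂, c₂⟩ := exists_oneState_of_code h₂ h₀
  obtain ⟨s₃, a₃, e₃, c₃⟩ := exists_oneState_of_code h₃ h₀
  have hone : -2 ≤ oneSum S₀ g₁ g₂ g₃ := by
    rw [oneSum_eq_oneOf a₁ e₁ c₁ a₂ e₂ c₂ a₃ e₃ c₃]; exact oneOf_ge _ _ _
  -- the pair of σ₀ pays
  have hpair : ∀ σ ∈ propers S₀, 0 ≤ pairSum S₀ g₁ g₂ g₃ σ :=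
    fun σ hσ => pairSum_nonneg_marked h₁ h₂ h₃ (Or.inl m₁) hσ
  have hfour : ∀ σ ∈ propers S₀, g₃ σ = 4 ∨ g₃ (S₀ \ σ) = 4 → 4 ≤ pairSum S₀ g₁ g₂ g₃ σ := by
    intro σ hσ h4
    obtain ⟨t₁, p₁, q₁, r₁⟩ := exists_pairState_of_code h₁ hσ
    obtain ⟨t₂, p₂, q₂, r₂⟩ := exists_pairState_of_code h₂ hσ
    obtain ⟨t₃, p₃, q₃, r₃⟩ := exists_pairState_of_code h₃ hσ
    rw [pairSum_eq_pairOf p₁ q₁ r₁ p₂ q₂ r₂ p₃ q₃ r₃]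
    refine pairOf_ge_four t₁ t₂ t₃ ((psL_ne_zero_iff t₁).2 (p₁ ▸ m₁)) ((psL_ne_zero_iff t₂).2 (p₂ ▸ m₂)) ?_ ?_
    · by_contra hlt
      have : psL t₃ ≠ 0 := (psL_ne_zero_iff t₃).1 (by omega)
      exact this (p₃.trans b₃)
    · rw [q₃, r₃]; exact h4
  have hσ₀' := sdiff_mem_propers hσ₀
  have hne : σ₀ ≠ S₀ \ σ₀ := by
    intro he
    obtain ⟨_, h2, _⟩ := mem_propers.1 hσ₀
    apply h2
    have : Disjoint σ₀ (S₀ \ σ₀) := disjoint_sdiff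
    rw [← he] at this
    exact disjoint_self.1 this
  have hsub : ({σ₀, S₀ \ σ₀} : Finset (Finset α)) ⊆ propers S₀ := by
    intro σ hσ
    rcases mem_insert.1 hσ with rfl | hσ
    · exact hσ₀
    · rw [mem_singleton.1 hσ]; exact hσ₀'
  have hge : pairSum S₀ g₁ g₂ g₃ σ₀ + pairSum S₀ g₁ g₂ g₃ (S₀ \ σ₀) ≤ ∑ σ ∈ propers S₀, pairSum S₀ g₁ g₂ g₃ σ := by
    rw [← sum_pair hne]
    exact sum_le_sum_of_subset_of_nonneg hsub fun σ hσ _ => hpair σ hσ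
  have h4a := hfour σ₀ hσ₀ (Or.inl hk)
  have h4b := hfour (S₀ \ σ₀) hσ₀' (Or.inr (by rw [Finset.sdiff_sdiff_eq_self (mem_propers.1 hσ₀).1]; exact hk))
  unfold codeD
  linarith

/-- **The marked sectors**: with at least one marked block, `codeD ≥ 0`. [this work] -/
theorem codeD_nonneg_marked (h₀ : S₀.Nonempty) (h₁ : IsCode S₀ g₁) (h₂ : IsCode S₀ g₂) (h₃ : IsCode S₀ g₃)
    (hm : g₁ ∅ ≠ 0 ∨ g₂ ∅ ≠ 0 ∨ g₃ ∅ ≠ 0) : 0 ≤ codeD S₀ g₁ g₂ g₃ := by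
  have hdec := two_mul_codeSum_sub h₀ g₁ g₂ g₃
  have hthree := threeSum_nonneg h₁ h₂ h₃
  have hpair : 0 ≤ ∑ σ ∈ propers S₀, pairSum S₀ g₁ g₂ g₃ σ :=
    sum_nonneg fun σ hσ => pairSum_nonneg_marked h₁ h₂ h₃ hm hσ
  obtain ⟨s₁, a₁, e₁, c₁⟩ := exists_oneState_of_code h₁ h₀
  obtain ⟨s₂, a₂, e₂, c₂⟩ := exists_oneState_of_code h₂ h₀
  obtain ⟨s₃, a₃, e₃, c₃⟩ := exists_oneState_of_code h₃ h₀
  have hone := oneSum_eq_oneOf a₁ e₁ c₁ a₂ e₂ c₂ a₃ e₃ c₃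
  by_cases hpos : 0 ≤ oneOf s₁ s₂ s₃
  · unfold codeD; linarith
  -- a negative one-block sum pins the configuration; the bottom block has a proper kernel trace
  have trace : ∀ {g : Finset α → Fin 5}, IsCode S₀ g → osL 4 = g ∅ → osTop 4 = g S₀ → osT 4 = rowT S₀ g →
      g ∅ = 0 ∧ ∃ σ₀ ∈ propers S₀, g σ₀ = 4 := by
    intro g hg a e c
    have a' : g ∅ = 0 := a.symm.trans (by decide)
    have e' : g S₀ = 4 := e.symm.trans (by decide)
    have c' : rowT S₀ g = 0 := c.symm.trans (by decide)
    refine ⟨a', ?_⟩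
    by_contra hno
    push Not at hno
    have hall : ∀ σ ∈ propers S₀, g σ = 3 := by
      intro σ hσ
      obtain ⟨h1, h2, _⟩ := mem_propers.1 hσ
      rcases hg.lift h1 (nonempty_iff_ne_empty.2 h2) with h3 | h4
      · exact h3
      · exact absurd h4 (hno σ hσ)
    have : rowT S₀ g = 1 := by rw [rowT, if_pos (Or.inr ⟨e', hall⟩)]
    rw [c'] at this; exact absurd this (by norm_num)
  have mk : ∀ {g : Finset α → Fin 5} {s : Fin 6}, osL s = g ∅ → s.val < 3 → g ∅ ≠ 0 :=
    fun a hs => a ▸ (osL_ne_zero_iff _).1 hs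
  rcases oneOf_neg_cases s₁ s₂ s₃ (by linarith) with ⟨rfl, k₂, k₃⟩ | ⟨rfl, k₁, k₃⟩ | ⟨rfl, k₁, k₂⟩
  · obtain ⟨b, σ₀, hσ₀, hk⟩ := trace h₁ a₁ e₁ c₁
    rw [codeD_swap12, codeD_swap23]
    exact codeD_nonneg_of_trace h₀ h₂ h₃ h₁ (mk a₂ k₂) (mk a₃ k₃) b hσ₀ hk
  · obtain ⟨b, σ₀, hσ₀, hk⟩ := trace h₂ a₂ e₂ c₂
    rw [codeD_swap23]
    exact codeD_nonneg_of_trace h₀ h₁ h₃ h₂ (mk a₁ k₁) (mk a₃ k₃) b hσ₀ hk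
  · obtain ⟨b, σ₀, hσ₀, hk⟩ := trace h₃ a₃ e₃ c₃
    exact codeD_nonneg_of_trace h₀ h₁ h₂ h₃ (mk a₁ k₁) (mk a₂ k₂) b hσ₀ hk

end codes


/-! ## The bottom sector -/

section bottom

variable {S₀ : Finset α} {g₁ g₂ g₃ : Finset α → Fin 5}

/-- The family `𝒟` of the bottom sector: proper traces that are petal in all three blocks with kernel complement in all three. [this work] -/
def dset (S₀ : Finset α) (g₁ g₂ g₃ : Finset α → Fin 5) : Finset (Finset α) :=
  (propers S₀).filter fun σ => g₁ σ = 3 ∧ g₂ σ = 3 ∧ g₃ σ = 3 ∧ g₁ (S₀ \ σ) = 4 ∧ g₂ (S₀ \ σ) = 4 ∧ g₃ (S₀ \ σ) = 4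

/-- Membership in `dset`. [this work] -/
theorem mem_dset {σ : Finset α} : σ ∈ dset S₀ g₁ g₂ g₃ ↔
    σ ∈ propers S₀ ∧ (g₁ σ = 3 ∧ g₂ σ = 3 ∧ g₃ σ = 3 ∧ g₁ (S₀ \ σ) = 4 ∧ g₂ (S₀ \ σ) = 4 ∧ g₃ (S₀ \ σ) = 4) := by
  unfold dset; rw [mem_filter]

/-- **The bottom sector**: three bottom blocks give `codeD ≥ 0` (charge form + the LEMMA). [this work] -/
theorem codeD_nonneg_bottom (h₀ : S₀.Nonempty) (h₁ : IsCode S₀ g₁) (h₂ : IsCode S₀ g₂) (h₃ : IsCode S₀ g₃)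
    (b₁ : g₁ ∅ = 0) (b₂ : g₂ ∅ = 0) (b₃ : g₃ ∅ = 0) (ι : α → ℕ) (hι : Function.Injective ι) :
    0 ≤ codeD S₀ g₁ g₂ g₃ := by
  have hdec := two_mul_codeSum_sub h₀ g₁ g₂ g₃
  set 𝒟 := dset S₀ g₁ g₂ g₃ with h𝒟
  -- one-block placements
  obtain ⟨s₁, a₁, e₁, c₁⟩ := exists_oneState_of_code h₁ h₀
  obtain ⟨s₂, a₂, e₂, c₂⟩ := exists_oneState_of_code h₂ h₀
  obtain ⟨s₃, a₃, e₃, c₃⟩ := exists_oneState_of_code h₃ h₀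
  have hone := oneSum_eq_oneOf a₁ e₁ c₁ a₂ e₂ c₂ a₃ e₃ c₃
  have bot : ∀ {g : Finset α → Fin 5} {s : Fin 6}, osL s = g ∅ → g ∅ = 0 → 3 ≤ s.val := by
    intro g s a b
    by_contra hlt
    exact ((osL_ne_zero_iff s).1 (by omega)) (a.trans b)
  have hob := oneOf_bottom s₁ s₂ s₃ (bot a₁ b₁) (bot a₂ b₂) (bot a₃ b₃)
  have hone0 : 0 ≤ oneSum S₀ g₁ g₂ g₃ := by rw [hone]; exact hob.1
  have hone12 : 𝒟.Nonempty → oneSum S₀ g₁ g₂ g₃ = 12 := by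
    rintro ⟨σ, hσ⟩
    obtain ⟨hσp, -, -, -, k₁, k₂, k₃⟩ := mem_dset.1 hσ
    have hsub : S₀ \ σ ⊆ S₀ := sdiff_subset
    rw [hone]
    refine hob.2 ?_ ?_ ?_
    · rw [e₁]; exact h₁.eq_four_of_subset hsub subset_rfl k₁
    · rw [e₂]; exact h₂.eq_four_of_subset hsub subset_rfl k₂
    · rw [e₃]; exact h₃.eq_four_of_subset hsub subset_rfl k₃
  -- complementary pairs
  have hpair : ∀ σ ∈ propers S₀,
      -12 * ((if σ ∈ 𝒟 then (1 : ℤ) else 0) + (if S₀ \ σ ∈ 𝒟 then (1 : ℤ) else 0)) ≤ pairSum S₀ g₁ g₂ g₃ σ := by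
    intro σ hσ
    obtain ⟨t₁, p₁, q₁, r₁⟩ := exists_pairState_of_code h₁ hσ
    obtain ⟨t₂, p₂, q₂, r₂⟩ := exists_pairState_of_code h₂ hσ
    obtain ⟨t₃, p₃, q₃, r₃⟩ := exists_pairState_of_code h₃ hσ
    have bot' : ∀ {g : Finset α → Fin 5} {t : Fin 7}, psL t = g ∅ → g ∅ = 0 → 3 ≤ t.val := by
      intro g t a b
      by_contra hlt
      exact ((psL_ne_zero_iff t).1 (by omega)) (a.trans b)
    have key := pairOf_bottom t₁ t₂ t₃ (bot' p₁ b₁) (bot' p₂ b₂) (bot' p₃ b₃)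
    rw [pairSum_eq_pairOf p₁ q₁ r₁ p₂ q₂ r₂ p₃ q₃ r₃]
    rw [q₁, q₂, q₃, r₁, r₂, r₃] at key
    have hσ' := sdiff_mem_propers hσ
    have eσ : S₀ \ (S₀ \ σ) = σ := Finset.sdiff_sdiff_eq_self (mem_propers.1 hσ).1
    have i1 : (if g₁ σ = 3 ∧ g₂ σ = 3 ∧ g₃ σ = 3 ∧ g₁ (S₀ \ σ) = 4 ∧ g₂ (S₀ \ σ) = 4 ∧ g₃ (S₀ \ σ) = 4 then (1 : ℤ) else 0)
        = (if σ ∈ 𝒟 then (1 : ℤ) else 0) := by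
      by_cases hc : g₁ σ = 3 ∧ g₂ σ = 3 ∧ g₃ σ = 3 ∧ g₁ (S₀ \ σ) = 4 ∧ g₂ (S₀ \ σ) = 4 ∧ g₃ (S₀ \ σ) = 4
      · rw [if_pos hc, if_pos (mem_dset.2 ⟨hσ, hc⟩)]
      · rw [if_neg hc, if_neg (fun hm => hc (mem_dset.1 hm).2)]
    have i2 : (if g₁ (S₀ \ σ) = 3 ∧ g₂ (S₀ \ σ) = 3 ∧ g₃ (S₀ \ σ) = 3 ∧ g₁ σ = 4 ∧ g₂ σ = 4 ∧ g₃ σ = 4 then (1 : ℤ) else 0)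
        = (if S₀ \ σ ∈ 𝒟 then (1 : ℤ) else 0) := by
      by_cases hc : g₁ (S₀ \ σ) = 3 ∧ g₂ (S₀ \ σ) = 3 ∧ g₃ (S₀ \ σ) = 3 ∧ g₁ σ = 4 ∧ g₂ σ = 4 ∧ g₃ σ = 4
      · rw [if_pos hc, if_pos (mem_dset.2 ⟨hσ', by rw [eσ]; exact hc⟩)]
      · rw [if_neg hc, if_neg (fun hm => hc (by have := (mem_dset.1 hm).2; rwa [eσ] at this))]
    rw [i1, i2] at key
    exact key
  have hcount : ∑ σ ∈ propers S₀, (if σ ∈ 𝒟 then (1 : ℤ) else 0) = 𝒟.card := by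
    rw [sum_boole]
    have : (propers S₀).filter (fun σ => σ ∈ 𝒟) = 𝒟 := by
      rw [filter_mem_eq_inter, inter_eq_right]
      exact filter_subset _ _
    rw [this]
  have hpairsum : -24 * (𝒟.card : ℤ) ≤ ∑ σ ∈ propers S₀, pairSum S₀ g₁ g₂ g₃ σ := by
    have h := sum_le_sum hpair
    rw [← mul_sum, sum_add_distrib, sum_propers_sdiff S₀ (fun σ => if σ ∈ 𝒟 then (1 : ℤ) else 0), hcount] at h
    linarith
  -- three-block placements
  set T := (placements3 S₀).filter (TwoIn S₀ 𝒟) with hT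
  have hthree : 4 * (T.card : ℤ) ≤ threeSum S₀ g₁ g₂ g₃ := by
    have e3 : threeSum S₀ g₁ g₂ g₃ = ∑ p ∈ placements3 S₀, club6 (g₁ p.1) (g₂ p.2) (g₃ (S₀ \ (p.1 ∪ p.2))) := by
      unfold threeSum placements3; rw [sum_sigma]
    have pt : ∀ p ∈ placements3 S₀,
        4 * (if TwoIn S₀ 𝒟 p then (1 : ℤ) else 0) ≤ club6 (g₁ p.1) (g₂ p.2) (g₃ (S₀ \ (p.1 ∪ p.2))) := by
      intro p hp
      rw [placements3, mem_sigma] at hp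
      obtain ⟨hX1, hX2, hY1, hY2, _, hZ1, hZ2⟩ := three_blocks hp.1 hp.2
      have l₁ := h₁.lift hX1 hX2
      have l₂ := h₂.lift hY1 hY2
      have l₃ := h₃.lift hZ1 hZ2
      by_cases h2 : TwoIn S₀ 𝒟 p
      · rw [if_pos h2, mul_one]
        refine club6_ge_four _ _ _ l₁ l₂ l₃ ?_
        rcases h2 with ⟨d1, d2⟩ | ⟨d1, d3⟩ | ⟨d2, d3⟩
        · exact Or.inl ⟨(mem_dset.1 d1).2.1, (mem_dset.1 d2).2.2.1⟩
        · exact Or.inr (Or.inl ⟨(mem_dset.1 d1).2.1, (mem_dset.1 d3).2.2.2.1⟩)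
        · exact Or.inr (Or.inr ⟨(mem_dset.1 d2).2.2.1, (mem_dset.1 d3).2.2.2.1⟩)
      · rw [if_neg h2, mul_zero]
        exact club6_nonneg_of_ge3 _ _ _ l₁ l₂ l₃
    have h := sum_le_sum pt
    rw [← mul_sum, sum_boole, ← e3] at h
    exact h
  -- the LEMMA
  have hL : 3 * ((𝒟.card : ℤ) - 1) ≤ (T.card : ℤ) := by
    refine card_twoIn_ge S₀ 𝒟 ι hι (filter_subset _ _) ?_ ?_
    · intro τ hτ τ' hτ'τ hne
      obtain ⟨hτp, k₁, k₂, k₃, m₁, m₂, m₃⟩ := mem_dset.1 hτ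
      obtain ⟨hτS, _, hτne⟩ := mem_propers.1 hτp
      have hsub : S₀ \ τ ⊆ S₀ \ τ' := sdiff_subset_sdiff subset_rfl hτ'τ
      refine mem_dset.2 ⟨mem_propers.2 ⟨hτ'τ.trans hτS, hne.ne_empty, fun he => hτne ?_⟩,
        h₁.eq_three_of_subset hτ'τ hτS hne k₁, h₂.eq_three_of_subset hτ'τ hτS hne k₂, h₃.eq_three_of_subset hτ'τ hτS hne k₃,
        h₁.eq_four_of_subset hsub sdiff_subset m₁, h₂.eq_four_of_subset hsub sdiff_subset m₂,
        h₃.eq_four_of_subset hsub sdiff_subset m₃⟩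
      exact Subset.antisymm hτS (he ▸ hτ'τ)
    · intro τ hτ v hv he
      have m₁ := (mem_dset.1 hτ).2.2.2.2.1
      have k₁ := (mem_dset.1 hv).2.1
      rw [he, k₁] at m₁
      exact absurd m₁ (by decide)
  -- assembly
  have hthree0 : 0 ≤ (T.card : ℤ) := Nat.cast_nonneg _
  unfold codeD
  rcases 𝒟.eq_empty_or_nonempty with he | hne
  · have : (𝒟.card : ℤ) = 0 := by rw [he, card_empty, Nat.cast_zero]
    rw [this] at hpairsum
    linarith
  · have := hone12 hne
    linarith

end bottom

/-- **POINTWISE THEOREM**: for every nonempty support `S₀` and every triple of block codes, the symmetrised placement sum dominates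
twice the symmetrised spectator rows: `2·codeRows ≤ codeSum`. [this work] -/
theorem two_mul_codeRows_le_codeSum {S₀ : Finset α} (h₀ : S₀.Nonempty) {g₁ g₂ g₃ : Finset α → Fin 5}
    (h₁ : IsCode S₀ g₁) (h₂ : IsCode S₀ g₂) (h₃ : IsCode S₀ g₃) (ι : α → ℕ) (hι : Function.Injective ι) :
    2 * codeRows S₀ g₁ g₂ g₃ ≤ codeSum S₀ g₁ g₂ g₃ := by
  suffices h : 0 ≤ codeD S₀ g₁ g₂ g₃ by unfold codeD at h; linarith
  by_cases m₁ : g₁ ∅ = 0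
  · by_cases m₂ : g₂ ∅ = 0
    · by_cases m₃ : g₃ ∅ = 0
      · exact codeD_nonneg_bottom h₀ h₁ h₂ h₃ m₁ m₂ m₃ ι hι
      · exact codeD_nonneg_marked h₀ h₁ h₂ h₃ (Or.inr (Or.inr m₃))
    · exact codeD_nonneg_marked h₀ h₁ h₂ h₃ (Or.inr (Or.inl m₂))
  · exact codeD_nonneg_marked h₀ h₁ h₂ h₃ (Or.inl m₁)

end Summit.CriticalPhenomena.PercolationContinuityZ3.Theorems.SunflowerPartition
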